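import Mathlib
import Summits.QuantumFields.BalabanUV.Beta.EriceRemainderEnclosureHistoryAutonomyComparisonAgeCompositionStaticChainHyperbolic
import Summits.QuantumFields.BalabanUV.Beta.EriceRemainderEnclosureHistoryAutonomyComparisonAgeCompositionStaticChainAdjacentEnvelopes
import Summits.QuantumFields.BalabanUV.Beta.EriceRemainderEnclosureHistoryAutonomyComparisonAgeCompositionStaticChainObserverRatios

/-!
# EriceRemainderEnclosureHistoryAutonomyComparisonAgeCompositionStaticChainAdjacentRatioEnvelopes — (E78f) THE LATTICE ENVELOPES, part 2: every older age of an
# adjacent pair `(z+1, z)`, `z ≥ 16`, has observer ratio `β_k ≤ 1.0607`; the REVERSE covariance bound `Ψ_yzΨ_zy ≤ Ψ_yyΨ_zz + ΔαΔβΨ_yy²`; the defect envelope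
# `θ̄(q) ≤ 0.7856` for every scale ratio `q ≥ 1`

Cell `pub-balaban`, β-function sub-cell, BINDER row D4 «RemainderConst leaves for Bałaban's split» (`HOME/BINDER-OWNERS.md`; owner lineage `b2b-balaban-beta-an4`;
this file by co-owner #2 lineage `b2b-balaban-beta-d4-p2`, generation 69), β-FLOW TEAM duty (1), FREEZE (0) honoured (def-free; imports (E72c) `…StaticChainHyperbolic`
(`thetabar_antitone`) and (E78e) `…AdjacentEnvelopes` (square-root toolkit; transitively (E78b) `wsum_shift`), (E78c) `…ObserverRatios` (`summand_cross_scale`); nothing restated).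

HONEST FRAMING (page 1, verbatim and binding).  *"Discharging BetaPertH makes Bałaban's UV stability UNCONDITIONAL — a real constructive-QFT result; it is
NOT the continuum limit and NOT the Clay problem."*  THIS FILE DISCHARGES NOTHING OF THE KIND.  Elementary real analysis — square roots, one exponential constant,
finite double sums — hypotheses of a census, not facts; the age profile of Bałaban's (1.22) limit functional is NOT PRINTED ([I] p. 298; GAPS G-t4-U2-1∕-2) and
NOT asserted.  Row D4 class UNCHANGED (critical-path width 0; instance 0∕1; D4 DISCHARGE NO DATE).  HONEST DEPENDENCY: continuum YM on T⁴ ⇐ BetaPertH ∧ nine spine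
estimates (0/9 proved); BetaPertH ⇐ (D1) ∧ (D4) ∧ CAP+tail; G-an2-4 gates asym, D1 and NE2/3/4.

THE POINT (census sense (α); route (N′); README `HOME/b2b-balaban-beta-d4-p2/g69/e78/README.md` §6).  The remaining numeric hypotheses of (E78d)
`adjacent_F_nonneg_crude` ∕ `adjacent_G_nonneg_crude` ∕ `c1_criterion_of_upper`: §1 **`read_ratio_le`** — `(z+1)·S_{z,k} ≤ 1.0607·z·S_{z+1,k}` for `z ≥ 16` and every
window `k` (the term ratio `g_z(l)∕g_{z+1}(l)` is largest at `l = 0`, (E78c) `summand_cross_scale`; `√(z(z+2)) ≤ 1.0607z`), so `β_k = ((z+1)∕z)S_{z,k}∕S_{z+1,k} ≤ 1.0607`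
and, with `α_k ∈ [z∕(z+1), 1]`, `P = Ψ_zz ∈ [(16∕17)Ψ_yy, 1.0607Ψ_yy]` and `ΔαΔβ ≤ (1∕17)(0.0607) ≤ 9∕2500`; **`covariance_bound_rev`** — the companion of (E78b)
`covariance_bound` in the other direction, giving the upper bound `Π ≤ σφ + σβ₊Ψ + φα₊Ψ + ΨΨ_zz + ΔαΔβΨ²`; §2 **`thetabar_le_envelope`** — `θ̄(q) ≤ 491∕625` for every
`q ≥ 1` (`thetabar_antitone`; `θ̄(1) = 1 − (1∕2)√(1∕2)e^{−1∕2} ≤ 0.785559` from `Real.exp_one_lt_d9`).  NOT CLAIMED: the wiring theorem; `z ≤ 15`; non-adjacent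
pairs; the assembly; the static closure; anything about the flow; printed.

WHAT IS PROVED ([folklore]; 0 `def`, 0 sorry).  §1 **`read_ratio_le`**, **`covariance_bound_rev`**.  §2 **`thetabar_le_envelope`**.
-/
noncomputable section
open Finset

namespace Summit.QuantumFields.BalabanUV.Beta.EriceRemainderEnclosureHistoryAutonomyComparisonAgeCompositionStaticChainAdjacentRatioEnvelopes

open Summit.QuantumFields.BalabanUV.Beta.EriceRemainderEnclosureHistoryAutonomyComparisonAgeCompositionStaticChainWindowBounds
open Summit.QuantumFields.BalabanUV.Beta.EriceRemainderEnclosureHistoryAutonomyComparisonAgeCompositionStaticChainWindowMass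
open Summit.QuantumFields.BalabanUV.Beta.EriceRemainderEnclosureHistoryAutonomyComparisonAgeCompositionStaticChainObserverRatios
open Summit.QuantumFields.BalabanUV.Beta.EriceRemainderEnclosureHistoryAutonomyComparisonAgeCompositionStaticChainResolvent
open Summit.QuantumFields.BalabanUV.Beta.EriceRemainderEnclosureHistoryAutonomyComparisonAgeCompositionStaticChainAdjacentEnvelopes

open Literature.NumberTheory.LFunctions.VdC.Num (sqrt_le_of_le_sq le_sqrt_of_sq_le)

/-! ## §1 Observer-ratio envelope and the reverse covariance bound -/

/-- **`β_k ≤ √(1+2∕z)` IN PRODUCT FORM**: `(z+1)·S_{z,k} ≤ (10607∕10000)·z·S_{z+1,k}` for `z ≥ 16` and every window `k` (the term ratio `g_z(l)∕g_{z+1}(l)` is largest at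
`l = 0`, (E78c) `summand_cross_scale`; `√(z(z+2)) ≤ 1.0607z` for `z ≥ 16`). With `β_k = (y∕z)S_{z,k}∕S_{y,k}`, `y = z+1`: `β_k ≤ 1.0607`. [folklore] -/
theorem read_ratio_le {z : ℕ} (hz : 16 ≤ z) (k : ℕ) :
    ((z : ℝ) + 1) * ∑ l ∈ range k, Real.sqrt ((z : ℝ) / ((z : ℝ) + l + 1))
      ≤ (10607 / 10000 : ℝ) * (z : ℝ) * ∑ l ∈ range k, Real.sqrt (((z : ℝ) + 1) / (((z : ℝ) + 1) + l + 1)) := by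
  have hz' : (16 : ℝ) ≤ z := by exact_mod_cast hz
  have hzp : (0 : ℝ) < z := by positivity
  -- termwise: `g_z(l) · g_{z+1}(0) ≤ g_z(0) · g_{z+1}(l)`
  have hterm : ∀ l ∈ range k, Real.sqrt ((z : ℝ) / ((z : ℝ) + l + 1)) * Real.sqrt (((z:ℝ) + 1) / (((z:ℝ) + 1) + (0:ℕ) + 1))
      ≤ Real.sqrt ((z : ℝ) / ((z : ℝ) + (0:ℕ) + 1)) * Real.sqrt (((z : ℝ) + 1) / (((z : ℝ) + 1) + l + 1)) :=
    fun l _ => summand_cross_scale hzp (by linarith) (Nat.zero_le l)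
  have hsum : (∑ l ∈ range k, Real.sqrt ((z : ℝ) / ((z : ℝ) + l + 1))) * Real.sqrt (((z:ℝ) + 1) / (((z:ℝ) + 1) + (0:ℕ) + 1))
      ≤ Real.sqrt ((z : ℝ) / ((z : ℝ) + (0:ℕ) + 1)) * ∑ l ∈ range k, Real.sqrt (((z : ℝ) + 1) / (((z : ℝ) + 1) + l + 1)) := by
    rw [sum_mul, mul_sum]; exact sum_le_sum hterm
  push_cast at hsum
  simp only [add_zero] at hsum
  -- numeric: `(z+1)·√(z/(z+1)) ≤ 1.0607·z·√((z+1)/(z+2))`  ⟸  squares: `(z+1) z ≤ 1.0607² z² (z+1)/(z+2)`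
  have hA : 0 < Real.sqrt (((z:ℝ) + 1) / ((z:ℝ) + 1 + 1)) := Real.sqrt_pos.mpr (by positivity)
  have hB : 0 ≤ Real.sqrt ((z:ℝ) / ((z:ℝ) + 1)) := Real.sqrt_nonneg _
  have hAA : Real.sqrt (((z:ℝ) + 1) / ((z:ℝ) + 1 + 1)) * Real.sqrt (((z:ℝ) + 1) / ((z:ℝ) + 1 + 1)) = ((z:ℝ) + 1) / ((z:ℝ) + 1 + 1) :=
    Real.mul_self_sqrt (by positivity)
  have hBB : Real.sqrt ((z:ℝ) / ((z:ℝ) + 1)) * Real.sqrt ((z:ℝ) / ((z:ℝ) + 1)) = (z:ℝ) / ((z:ℝ) + 1) := Real.mul_self_sqrt (by positivity)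
  have hcmp : ((z:ℝ) + 1) * Real.sqrt ((z:ℝ) / ((z:ℝ) + 1)) ≤ (10607 / 10000 : ℝ) * z * Real.sqrt (((z:ℝ) + 1) / ((z:ℝ) + 1 + 1)) := by
    have eL : ((z:ℝ) + 1) * Real.sqrt ((z:ℝ) / ((z:ℝ) + 1)) = Real.sqrt (((z:ℝ) + 1) ^ 2 * ((z:ℝ) / ((z:ℝ) + 1))) := by
      rw [Real.sqrt_mul (sq_nonneg _), Real.sqrt_sq (by positivity)]
    have eR : (10607 / 10000 : ℝ) * z * Real.sqrt (((z:ℝ) + 1) / ((z:ℝ) + 1 + 1)) = Real.sqrt (((10607 / 10000 : ℝ) * z) ^ 2 * (((z:ℝ) + 1) / ((z:ℝ) + 1 + 1))) := by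
      rw [Real.sqrt_mul (sq_nonneg _), Real.sqrt_sq (by positivity)]
    rw [eL, eR]
    apply Real.sqrt_le_sqrt
    have e1 : ((z:ℝ) + 1) ^ 2 * ((z:ℝ) / ((z:ℝ) + 1)) = ((z:ℝ) + 1) * z := by field_simp
    have e2 : ((10607 / 10000 : ℝ) * z) ^ 2 * (((z:ℝ) + 1) / ((z:ℝ) + 1 + 1)) = ((10607 / 10000 : ℝ) ^ 2 * z ^ 2 * ((z:ℝ) + 1)) / ((z:ℝ) + 2) := by ring
    rw [e1, e2, le_div_iff₀ (by positivity)]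
    nlinarith [mul_nonneg (mul_nonneg hzp.le hzp.le) (by linarith : (0:ℝ) ≤ (z:ℝ) + 1)]
  have hS0 : 0 ≤ ∑ l ∈ range k, Real.sqrt (((z : ℝ) + 1) / (((z : ℝ) + 1) + l + 1)) := sum_nonneg fun _ _ => Real.sqrt_nonneg _
  have hT0 : 0 ≤ ∑ l ∈ range k, Real.sqrt ((z : ℝ) / ((z : ℝ) + l + 1)) := sum_nonneg fun _ _ => Real.sqrt_nonneg _
  -- from `T·a ≤ b·S` and `(z+1) b ≤ 1.0607 z a` with `a > 0`:  `(z+1) T a ≤ (z+1) b S ≤ 1.0607 z a S`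
  have h3 : ((z:ℝ) + 1) * (∑ l ∈ range k, Real.sqrt ((z : ℝ) / ((z : ℝ) + l + 1))) * Real.sqrt (((z:ℝ) + 1) / ((z:ℝ) + 1 + 1))
      ≤ (10607 / 10000 : ℝ) * z * (∑ l ∈ range k, Real.sqrt (((z : ℝ) + 1) / (((z : ℝ) + 1) + l + 1))) * Real.sqrt (((z:ℝ) + 1) / ((z:ℝ) + 1 + 1)) := by
    nlinarith [mul_le_mul_of_nonneg_left hsum (by positivity : (0:ℝ) ≤ (z:ℝ) + 1), mul_le_mul_of_nonneg_right hcmp hS0]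
  exact le_of_mul_le_mul_right h3 hA

/-- **THE REVERSE COVARIANCE BOUND**: in the letters of (E78b) `covariance_bound`, also `(ΣΣWα)(ΣΣWβ) ≤ (ΣΣW)(ΣΣWαβ) + ΔαΔβ(ΣΣW)²` — so
`Ψ_yzΨ_zy ≤ Ψ_yyΨ_zz + ΔαΔβΨ_yy²`, the upper bound on `Π` used by `c1_criterion_of_upper`. [folklore] -/
theorem covariance_bound_rev {n : ℕ} (W : ℕ → ℕ → ℝ) (α β : ℕ → ℝ) (α₀ β₀ Δα Δβ : ℝ)
    (hW : ∀ i l, i < n → l < n → 0 ≤ W i l)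
    (hα : ∀ i, i < n → α₀ ≤ α i ∧ α i ≤ α₀ + Δα) (hβ : ∀ l, l < n → β₀ ≤ β l ∧ β l ≤ β₀ + Δβ) :
    (∑ i ∈ range n, ∑ l ∈ range n, W i l * α i) * (∑ i ∈ range n, ∑ l ∈ range n, W i l * β l) ≤
      (∑ i ∈ range n, ∑ l ∈ range n, W i l) * (∑ i ∈ range n, ∑ l ∈ range n, W i l * (α i * β l))
        + Δα * Δβ * (∑ i ∈ range n, ∑ l ∈ range n, W i l) ^ 2 := by
  set Sw := ∑ i ∈ range n, ∑ l ∈ range n, W i l with hSw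
  set Sa := ∑ i ∈ range n, ∑ l ∈ range n, W i l * α i with hSa
  set Sb := ∑ i ∈ range n, ∑ l ∈ range n, W i l * β l with hSb
  set Sab := ∑ i ∈ range n, ∑ l ∈ range n, W i l * (α i * β l) with hSab
  have hXid : ∑ i ∈ range n, ∑ l ∈ range n, W i l * ((α i - α₀) * (β l - β₀)) = Sab - β₀ * Sa - α₀ * Sb + α₀ * β₀ * Sw :=
    Summit.QuantumFields.BalabanUV.Beta.EriceRemainderEnclosureHistoryAutonomyComparisonAgeCompositionStaticChainResolvent.wsum_shift W α β α₀ β₀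
  have hSw0 : 0 ≤ Sw := sum_nonneg fun i hi => sum_nonneg fun l hl => hW i l (mem_range.mp hi) (mem_range.mp hl)
  have hX0 : 0 ≤ ∑ i ∈ range n, ∑ l ∈ range n, W i l * ((α i - α₀) * (β l - β₀)) :=
    sum_nonneg fun i hi => sum_nonneg fun l hl => mul_nonneg (hW i l (mem_range.mp hi) (mem_range.mp hl))
      (mul_nonneg (by linarith [(hα i (mem_range.mp hi)).1]) (by linarith [(hβ l (mem_range.mp hl)).1]))
  have hYa : 0 ≤ Sa - α₀ * Sw ∧ Sa - α₀ * Sw ≤ Δα * Sw := by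
    have e : Sa - α₀ * Sw = ∑ i ∈ range n, ∑ l ∈ range n, W i l * (α i - α₀) := by
      rw [hSa, hSw, mul_sum, ← sum_sub_distrib]; refine sum_congr rfl fun i _ => ?_
      rw [mul_sum, ← sum_sub_distrib]; exact sum_congr rfl fun l _ => by ring
    have e2 : Δα * Sw = ∑ i ∈ range n, ∑ l ∈ range n, W i l * Δα := by
      rw [hSw, mul_sum]; refine sum_congr rfl fun i _ => ?_; rw [mul_sum]; exact sum_congr rfl fun l _ => by ring
    rw [e, e2]
    exact ⟨sum_nonneg fun i hi => sum_nonneg fun l hl => mul_nonneg (hW i l (mem_range.mp hi) (mem_range.mp hl)) (by linarith [(hα i (mem_range.mp hi)).1]),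
      sum_le_sum fun i hi => sum_le_sum fun l hl => mul_le_mul_of_nonneg_left (by linarith [(hα i (mem_range.mp hi)).2]) (hW i l (mem_range.mp hi) (mem_range.mp hl))⟩
  have hYb : 0 ≤ Sb - β₀ * Sw ∧ Sb - β₀ * Sw ≤ Δβ * Sw := by
    have e : Sb - β₀ * Sw = ∑ i ∈ range n, ∑ l ∈ range n, W i l * (β l - β₀) := by
      rw [hSb, hSw, mul_sum, ← sum_sub_distrib]; refine sum_congr rfl fun i _ => ?_
      rw [mul_sum, ← sum_sub_distrib]; exact sum_congr rfl fun l _ => by ring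
    have e2 : Δβ * Sw = ∑ i ∈ range n, ∑ l ∈ range n, W i l * Δβ := by
      rw [hSw, mul_sum]; refine sum_congr rfl fun i _ => ?_; rw [mul_sum]; exact sum_congr rfl fun l _ => by ring
    rw [e, e2]
    exact ⟨sum_nonneg fun i hi => sum_nonneg fun l hl => mul_nonneg (hW i l (mem_range.mp hi) (mem_range.mp hl)) (by linarith [(hβ l (mem_range.mp hl)).1]),
      sum_le_sum fun i hi => sum_le_sum fun l hl => mul_le_mul_of_nonneg_left (by linarith [(hβ l (mem_range.mp hl)).2]) (hW i l (mem_range.mp hi) (mem_range.mp hl))⟩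
  have hT : Sw * Sab - Sa * Sb = Sw * (∑ i ∈ range n, ∑ l ∈ range n, W i l * ((α i - α₀) * (β l - β₀))) - (Sa - α₀ * Sw) * (Sb - β₀ * Sw) := by
    rw [hXid]; ring
  nlinarith [mul_le_mul hYa.2 hYb.2 hYb.1 (le_trans hYa.1 hYa.2), mul_nonneg hSw0 hX0]

/-! ## §2 The defect envelope: `θ̄(q) ≤ 0.7856` for `q ≥ 1` -/

open Summit.QuantumFields.BalabanUV.Beta.EriceRemainderEnclosureHistoryAutonomyComparisonAgeCompositionStaticChainHyperbolic in
/-- **`θ̄(q) ≤ 491∕625 = 0.7856`** for every scale ratio `q ≥ 1` (`θ̄` non-increasing, `thetabar_antitone`; `θ̄(1) = 1 − (1∕2)√(1∕2)e^{−1∕2} ≤ 0.785559` from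
`e ≤ 2.7182818286`). [folklore] -/
theorem thetabar_le_envelope {q : ℝ} (hq : 1 ≤ q) :
    1 - q / (q + 1) * Real.sqrt (q / (q + 1)) * Real.exp (-(1 / (2 * q))) ≤ 491 / 625 := by
  have h := thetabar_antitone (r := 1) (r' := q) one_pos hq
  refine le_trans h ?_
  -- `θ̄(1) = 1 − (1/2) √(1/2) e^{−1/2}`
  have hs : (7071067 / 10000000 : ℝ) ≤ Real.sqrt ((1:ℝ) / (1 + 1)) := le_sqrt_of_sq_le (by norm_num) (by norm_num)
  have he1 := Real.exp_one_lt_d9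
  have hexp : (606530 / 1000000 : ℝ) ≤ Real.exp (-(1 / (2 * (1:ℝ)))) := by
    have e2 : Real.exp (-(1 / (2 * (1:ℝ)))) * Real.exp (-(1 / (2 * (1:ℝ)))) = (Real.exp 1)⁻¹ := by
      rw [← Real.exp_add, ← Real.exp_neg]; norm_num
    have hpos : 0 < Real.exp (-(1 / (2 * (1:ℝ)))) := Real.exp_pos _
    have hinv : (3678787 / 10000000 : ℝ) ≤ (Real.exp 1)⁻¹ := by
      rw [le_inv_comm₀ (by norm_num) (Real.exp_pos 1)]; linarith
    by_contra hcon
    have hcon' : Real.exp (-(1 / (2 * (1:ℝ)))) < 606530 / 1000000 := not_le.mp hcon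
    have : Real.exp (-(1 / (2 * (1:ℝ)))) * Real.exp (-(1 / (2 * (1:ℝ)))) < (606530 / 1000000) * (606530 / 1000000) :=
      mul_lt_mul'' hcon' hcon' hpos.le hpos.le
    rw [e2] at this
    linarith
  have hprod : (7071067 / 10000000 : ℝ) * (606530 / 1000000) ≤ Real.sqrt ((1:ℝ) / (1 + 1)) * Real.exp (-(1 / (2 * (1:ℝ)))) :=
    mul_le_mul hs hexp (by norm_num) (Real.sqrt_nonneg _)
  have e3 : (1:ℝ) / (1 + 1) * Real.sqrt (1 / (1 + 1)) * Real.exp (-(1 / (2 * 1))) = (1/2) * (Real.sqrt ((1:ℝ) / (1 + 1)) * Real.exp (-(1 / (2 * (1:ℝ))))) := by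
    ring
  rw [e3]
  nlinarith

end Summit.QuantumFields.BalabanUV.Beta.EriceRemainderEnclosureHistoryAutonomyComparisonAgeCompositionStaticChainAdjacentRatioEnvelopes

end
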